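import Literature.Probability.RandomPlanarGeometry.SAWStripPartitionFunction
import Literature.Probability.RandomPlanarGeometry.SupercriticalSAWProp3Holds
import Literature.Probability.RandomPlanarGeometry.SAWBridgeRadius
import Literature.Probability.Percolation.SiteConnectionTools
import Literature.Probability.Percolation.PlanarDuality
import HarnessLib

/-!
# Width transition — stub `stub_widthTransition` of line `rectangle-windows`
(crux EdgeOfPositivity, stmt-CriticalPhenomena-11344)

For a fugacity `x` with `x_c < x < 1` there is a width `W ≥ 2` such that the one-strand
"through" partition function
`Thr[x, W, ℓ] = Σ_s x^s · #{s-step SAWs (0,1) → (ℓ,1) of ℤ² inside {0..ℓ} × {1..W}}`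
is supercritical at some span (`x · Thr[x, W, ℓ] > 1`) while the strip of width `W - 1` is
subcritical at every span (`x · Thr[x, W - 1, ℓ] ≤ 1`).

Proof.
* A supercritical width exists.  Step 1 of the proof of Lemma 5 of Duminil-Copin–Kozma–Yadin
  2014 (`SAW.DKY2014_lem5_step1_holds`: at least `e^{-c√n} μⁿ` rectangle walks with `n` steps),
  the pigeonhole of an endpoint `(k,l)` (`SAW.exists_kl_rectangleWalkCount_le`) and the growth
  `(xμ)ⁿ e^{-c√n}/(2n+1)² → ∞` (`SAW.tendsto_pow_mul_exp_neg_sqrt_div`, `xμ > 1`) give `n, k, l`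
  with `x^{n+1} N > 1`, `N` the number of `n`-step rectangle walks `(0,0) → (k,l)`.  A pair
  `(p, q)` of them — `p` shifted up one row, one horizontal step `(k,l+1) → (k+1,l+1)`, then the
  left–right mirror image of `q` placed in the columns `k+1, …, 2k+1` and run backwards — is a
  `(2n+1)`-step SAW from `(0,1)` to `(2k+1,1)` inside `{0..2k+1} × {1..l+1}`; the gluing is
  injective (the two halves are recovered from the support), so
  `x · Thr[x, l+1, 2k+1] ≥ x^{2n+2} N² > 1`.
* Minimal width.  `W := Nat.find` of the supercritical widths.  Width `0` has an empty box; in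
  width `1` the only SAW `(0,1) → (ℓ,1)` in the one-row box is the straight one (a lattice walk
  displaces the column by at most its number of steps, a self-avoiding walk in the one-row box has
  at most `ℓ` steps, and a walk realising the maximal displacement is unique), so
  `x · Thr[x, 1, ℓ] ≤ x · x^ℓ ≤ 1`.  Hence `W ≥ 2`, and minimality of `W` is the subcritical
  clause for `W - 1`.

Sources: folklore lattice combinatorics (the Hammersley–Whittington strip monotonicity
`μ(strip_W) ↑ μ` in elementary form); H. Duminil-Copin, G. Kozma, A. Yadin, *Supercritical
self-avoiding walks are space-filling*, Ann. IHP Probab. Stat. 50 (2014), Lemma 5 (vendored and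
proved in `Literature.Probability.RandomPlanarGeometry.SupercriticalSAWProp3Holds`).
-/

noncomputable section

open Finset Filter
open Literature.Probability.LatticeModels Literature.Probability.RandomPlanarGeometry
open Literature.Probability.Percolation (zdGraph_two_adj_iff)

namespace Summit.CriticalPhenomena.SAWScalingLimit.Theorems.EdgeOfPositivity.RectangleWindows.WidthTransition

local notation3 (prettyPrint := false) "Zs[" x ", " n ", " ℓ ", " a ", " b "]" =>
  (∑ s ∈ Finset.range ((ℓ + 1) * n + 1), (x : ℝ) ^ s * ((SAW.stripSAWs n ℓ s a b).card : ℝ))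

local notation3 (prettyPrint := false) "Thr[" x ", " n ", " ℓ "]" =>
  (∑ s ∈ Finset.range ((ℓ + 1) * n + 1),
    (x : ℝ) ^ s * ((SAW.stripSAWs n ℓ s (![0, 1] : Site 2) (![((ℓ : ℕ) : ℤ), 1] : Site 2)).card : ℝ))

/-! ### Lattice walks: column displacement and tight walks -/

/-- A nearest-neighbour walk of `ℤ²` displaces the first coordinate by at most its number of
steps. [folklore] -/
theorem col_le_length {u v : Site 2} (p : (zdGraph 2).Walk u v) :
    v 0 ≤ u 0 + (p.length : ℤ) := by
  induction p with
  | nil => simp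
  | cons h q ih =>
    have ha := (zdGraph_two_adj_iff _ _).1 h
    simp only [SimpleGraph.Walk.length_cons, Nat.cast_add, Nat.cast_one]
    omega

/-- A walk of `ℤ²` realising the maximal column displacement (as many steps as columns gained)
is unique: every step is the unit step to the right. [folklore] -/
theorem eq_of_tight {u v : Site 2} (p : (zdGraph 2).Walk u v) :
    ∀ p' : (zdGraph 2).Walk u v, u 0 + (p.length : ℤ) = v 0 → u 0 + (p'.length : ℤ) = v 0 →
      p = p' := by
  induction p with
  | nil =>
    intro p' _ hp'
    cases p' with
    | nil => rfl
    | cons h q =>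
      simp only [SimpleGraph.Walk.length_cons, Nat.cast_add, Nat.cast_one] at hp'
      omega
  | @cons a b c h q ih =>
    intro p' hp hp'
    cases p' with
    | nil =>
      simp only [SimpleGraph.Walk.length_cons, Nat.cast_add, Nat.cast_one] at hp
      omega
    | @cons _ b' _ h' q' =>
      simp only [SimpleGraph.Walk.length_cons, Nat.cast_add, Nat.cast_one] at hp hp'
      have hc := col_le_length q
      have hc' := col_le_length q'
      have ha := (zdGraph_two_adj_iff _ _).1 h
      have ha' := (zdGraph_two_adj_iff _ _).1 h'
      have hb : b' = b := by
        rw [Site.eq_iff_two]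
        omega
      subst hb
      obtain rfl := ih q' (by omega) (by omega)
      rfl

/-! ### Widths `0` and `1` are never supercritical -/

/-- In width `0` the box is empty: `Thr[x, 0, ℓ] = 0`. [folklore] -/
theorem thr_zero (x : ℝ) (ℓ : ℕ) : Thr[x, 0, ℓ] = 0 := by
  refine Finset.sum_eq_zero fun s _ => ?_
  have h : SAW.stripSAWs 0 ℓ s (![0, 1] : Site 2) (![((ℓ : ℕ) : ℤ), 1] : Site 2) = ∅ :=
    SAW.stripSAWs_eq_empty_of_start (by simp) s _
  rw [h, Finset.card_empty, Nat.cast_zero, mul_zero]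

/-- In the one-row box `{0..ℓ} × {1}` there is no SAW `(0,1) → (ℓ,1)` with `s ≠ ℓ` steps (at
least `ℓ` steps are needed to gain `ℓ` columns, and a self-avoiding walk visits at most the
`ℓ + 1` sites of the box). [folklore] -/
theorem stripSAWs_one_eq_empty {ℓ s : ℕ} (hs : s ≠ ℓ) :
    SAW.stripSAWs 1 ℓ s (![0, 1] : Site 2) (![((ℓ : ℕ) : ℤ), 1] : Site 2) = ∅ :=
  Finset.eq_empty_of_forall_notMem fun p hp => by
    obtain ⟨hl, -, -⟩ := SAW.mem_stripSAWs.1 hp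
    have h1 := SAW.lt_of_mem_stripSAWs hp
    have h2 := col_le_length p
    simp only [Matrix.cons_val_zero] at h2
    omega

/-- In the one-row box there is at most one SAW `(0,1) → (ℓ,1)` with `s` steps (the straight
one). [folklore] -/
theorem card_stripSAWs_one_le_one (ℓ s : ℕ) :
    (SAW.stripSAWs 1 ℓ s (![0, 1] : Site 2) (![((ℓ : ℕ) : ℤ), 1] : Site 2)).card ≤ 1 :=
  Finset.card_le_one.2 fun p hp p' hp' => by
    obtain ⟨hl, -, -⟩ := SAW.mem_stripSAWs.1 hp
    obtain ⟨hl', -, -⟩ := SAW.mem_stripSAWs.1 hp'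
    have h1 := SAW.lt_of_mem_stripSAWs hp
    have h2 := col_le_length p
    have h2' := col_le_length p'
    simp only [Matrix.cons_val_zero] at h2 h2'
    exact eq_of_tight p p' (by simp only [Matrix.cons_val_zero]; omega)
      (by simp only [Matrix.cons_val_zero]; omega)

/-- In width `1`, `Thr[x, 1, ℓ] ≤ x^ℓ ≤ 1` for `0 ≤ x ≤ 1`. [folklore] -/
theorem thr_one_le_one {x : ℝ} (hx0 : 0 ≤ x) (hx1 : x ≤ 1) (ℓ : ℕ) : Thr[x, 1, ℓ] ≤ 1 := by
  rw [Finset.sum_eq_single ℓ (fun s _ hs => by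
      rw [stripSAWs_one_eq_empty hs, Finset.card_empty, Nat.cast_zero, mul_zero])
    (fun h => absurd (Finset.mem_range.2 (by omega)) h)]
  calc x ^ ℓ * ((SAW.stripSAWs 1 ℓ ℓ (![0, 1] : Site 2) (![((ℓ : ℕ) : ℤ), 1] : Site 2)).card : ℝ)
      ≤ x ^ ℓ * 1 := mul_le_mul_of_nonneg_left (by exact_mod_cast card_stripSAWs_one_le_one ℓ ℓ)
        (pow_nonneg hx0 _)
    _ ≤ 1 := by rw [mul_one]; exact pow_le_one₀ hx0 hx1

/-! ### A single term bounds the box partition function from below -/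

/-- `x^s · #(s-step SAWs of the box) ≤ Zs` for `x ≥ 0` (terms beyond the cutoff vanish).
[folklore] -/
theorem term_le_zs {x : ℝ} (hx : 0 ≤ x) (n ℓ s : ℕ) (a b : Site 2) :
    x ^ s * ((SAW.stripSAWs n ℓ s a b).card : ℝ) ≤ Zs[x, n, ℓ, a, b] := by
  by_cases hs : s ∈ Finset.range ((ℓ + 1) * n + 1)
  · exact Finset.single_le_sum (f := fun t => x ^ t * ((SAW.stripSAWs n ℓ t a b).card : ℝ))
      (fun t _ => by positivity) hs
  · have hs' : (ℓ + 1) * n ≤ s := by rw [Finset.mem_range, not_lt] at hs; omega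
    rw [SAW.stripSAWs_eq_empty hs' a b, Finset.card_empty, Nat.cast_zero, mul_zero]
    exact Finset.sum_nonneg fun t _ => by positivity

/-! ### Gluing two rectangle walks into a through walk of a strip -/

/-- Transport of a walk of `ℤ²` along a map preserving adjacency, with the mapped support.
[folklore] -/
theorem exists_walk_support_map (f : Site 2 → Site 2)
    (hf : ∀ a b : Site 2, (zdGraph 2).Adj a b → (zdGraph 2).Adj (f a) (f b)) {u v : Site 2}
    (p : (zdGraph 2).Walk u v) {a b : Site 2} (ha : f u = a) (hb : f v = b) :
    ∃ p' : (zdGraph 2).Walk a b, p'.support = p.support.map f := by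
  subst ha hb
  induction p with
  | nil => exact ⟨SimpleGraph.Walk.nil, by simp⟩
  | cons h q ih =>
    obtain ⟨q', hq'⟩ := ih
    exact ⟨SimpleGraph.Walk.cons (hf _ _ h) q', by simp [hq']⟩

/-- The shift up by one row preserves adjacency. [folklore] -/
theorem adj_shiftUp {a b : Site 2} (h : (zdGraph 2).Adj a b) :
    (zdGraph 2).Adj (![a 0, a 1 + 1] : Site 2) (![b 0, b 1 + 1] : Site 2) := by
  rw [zdGraph_two_adj_iff] at h ⊢
  simp only [Matrix.cons_val_zero, Matrix.cons_val_one, Matrix.cons_val_fin_one]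
  omega

/-- The column mirror `c ↦ C - c` followed by the shift up by one row preserves adjacency.
[folklore] -/
theorem adj_mirrorUp (C : ℤ) {a b : Site 2} (h : (zdGraph 2).Adj a b) :
    (zdGraph 2).Adj (![C - a 0, a 1 + 1] : Site 2) (![C - b 0, b 1 + 1] : Site 2) := by
  rw [zdGraph_two_adj_iff] at h ⊢
  simp only [Matrix.cons_val_zero, Matrix.cons_val_one, Matrix.cons_val_fin_one]
  omega

/-- **Gluing.** Two walks `p, q : (0,0) → (k,l)` of `ℤ²` give the walk
`(p shifted up one row) · ((k,l+1) → (k+1,l+1)) · (q mirrored into the columns k+1..2k+1, run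
backwards)` from `(0,1)` to `(2k+1,1)`, with the displayed support. [folklore] -/
theorem exists_glued_walk (k l : ℕ)
    (p q : (zdGraph 2).Walk (0 : Site 2) (SAW.RectanglePair.kl k l)) :
    ∃ w : (zdGraph 2).Walk (![0, 1] : Site 2) (![((2 * k + 1 : ℕ) : ℤ), 1] : Site 2),
      w.support = p.support.map (fun u => (![u 0, u 1 + 1] : Site 2)) ++
        (q.support.map (fun u => (![(2 * k + 1 : ℤ) - u 0, u 1 + 1] : Site 2))).reverse := by
  obtain ⟨p', hp'⟩ := exists_walk_support_map (fun u => (![u 0, u 1 + 1] : Site 2))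
    (fun _ _ h => adj_shiftUp h) p (a := ![0, 1]) (b := ![(k : ℤ), (l : ℤ) + 1])
    (by funext i; fin_cases i <;> simp)
    (by funext i; fin_cases i <;> simp [SAW.RectanglePair.kl])
  obtain ⟨q', hq'⟩ := exists_walk_support_map
    (fun u => (![(2 * k + 1 : ℤ) - u 0, u 1 + 1] : Site 2)) (fun _ _ h => adj_mirrorUp _ h) q
    (a := ![((2 * k + 1 : ℕ) : ℤ), 1]) (b := ![(k : ℤ) + 1, (l : ℤ) + 1])
    (by funext i; fin_cases i <;> simp)
    (by
      funext i
      fin_cases i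
      · simp [SAW.RectanglePair.kl]; ring
      · simp [SAW.RectanglePair.kl])
  have hadj : (zdGraph 2).Adj (![(k : ℤ), (l : ℤ) + 1] : Site 2) ![(k : ℤ) + 1, (l : ℤ) + 1] := by
    rw [zdGraph_two_adj_iff]
    simp
  exact ⟨p'.append (SimpleGraph.Walk.cons hadj q'.reverse), by
    rw [SimpleGraph.Walk.support_append, SimpleGraph.Walk.support_cons, List.tail_cons,
      SimpleGraph.Walk.support_reverse, hp', hq']⟩

/-- **Pairs of rectangle walks inject into through walks.** With `N` the number of `n`-step
rectangle walks `(0,0) → (k,l)` (self-avoiding, inside `[0,k] × [0,l]`), the strip of width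
`l + 1` and span `2k + 1` carries at least `N²` self-avoiding walks `(0,1) → (2k+1,1)` with
`2n + 1` steps: the glued walk of a pair is self-avoiding (its two halves live in the disjoint
column ranges `0..k` and `k+1..2k+1`), lies in the box, and the pair is recovered from its
support. [folklore] -/
theorem sq_card_rectangleWalksTo_le (k l n : ℕ) :
    (SAW.rectangleWalksTo n (SAW.RectanglePair.kl k l)).card ^ 2 ≤
      (SAW.stripSAWs (l + 1) (2 * k + 1) (2 * n + 1) (![0, 1] : Site 2)
        (![((2 * k + 1 : ℕ) : ℤ), 1] : Site 2)).card := by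
  classical
  set R := SAW.rectangleWalksTo n (SAW.RectanglePair.kl k l) with hR
  set S := SAW.stripSAWs (l + 1) (2 * k + 1) (2 * n + 1) (![0, 1] : Site 2)
    (![((2 * k + 1 : ℕ) : ℤ), 1] : Site 2) with hS
  -- membership in `R`, in coordinates
  have hmem : ∀ {p : (zdGraph 2).Walk (0 : Site 2) (SAW.RectanglePair.kl k l)}, p ∈ R →
      p.length = n ∧ p.IsPath ∧
        ∀ w ∈ p.support, (0 ≤ w 0 ∧ w 0 ≤ (k : ℤ)) ∧ (0 ≤ w 1 ∧ w 1 ≤ (l : ℤ)) := by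
    intro p hp
    obtain ⟨hlen, hpath, hrect⟩ := SAW.mem_rectangleWalksTo.1 hp
    refine ⟨hlen, hpath, fun w hw => ⟨?_, ?_⟩⟩
    · simpa [SAW.RectanglePair.kl] using hrect w hw 0
    · simpa [SAW.RectanglePair.kl] using hrect w hw 1
  -- the two coordinate maps are injective
  have hinj₁ : Function.Injective fun u : Site 2 => (![u 0, u 1 + 1] : Site 2) := by
    intro u u' h
    have h0 := congrFun h 0
    have h1 := congrFun h 1
    simp only [Matrix.cons_val_zero, Matrix.cons_val_one, Matrix.cons_val_fin_one] at h0 h1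
    rw [Site.eq_iff_two]
    omega
  have hinj₂ :
      Function.Injective fun u : Site 2 => (![(2 * k + 1 : ℤ) - u 0, u 1 + 1] : Site 2) := by
    intro u u' h
    have h0 := congrFun h 0
    have h1 := congrFun h 1
    simp only [Matrix.cons_val_zero, Matrix.cons_val_one, Matrix.cons_val_fin_one] at h0 h1
    rw [Site.eq_iff_two]
    omega
  -- the support of the glued walk, as an injective function of the pair, lands in `S.image support`
  have key : (R ×ˢ R).card ≤ (S.image SimpleGraph.Walk.support).card := by
    refine Finset.card_le_card_of_injOn
      (fun pq => pq.1.support.map (fun u => (![u 0, u 1 + 1] : Site 2)) ++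
        (pq.2.support.map (fun u => (![(2 * k + 1 : ℤ) - u 0, u 1 + 1] : Site 2))).reverse)
      (fun pq hpq => ?_) ?_
    · -- lands in the supports of `S`
      obtain ⟨hp, hq⟩ := Finset.mem_product.1 (Finset.mem_coe.1 hpq)
      obtain ⟨hpl, hpp, hpb⟩ := hmem hp
      obtain ⟨hql, hqp, hqb⟩ := hmem hq
      obtain ⟨w, hw⟩ := exists_glued_walk k l pq.1 pq.2
      refine Finset.mem_coe.2 (Finset.mem_image.2 ⟨w, ?_, hw⟩)
      rw [hS, SAW.mem_stripSAWs]
      refine ⟨?_, ?_, ?_⟩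
      · have h := congrArg List.length hw
        simp only [SimpleGraph.Walk.length_support, List.length_append, List.length_map,
          List.length_reverse, hpl, hql] at h
        omega
      · refine SimpleGraph.Walk.IsPath.mk' ?_
        rw [hw, List.nodup_append]
        refine ⟨hpp.support_nodup.map hinj₁, List.nodup_reverse.2 (hqp.support_nodup.map hinj₂),
          fun a ha b hb hab => ?_⟩
        obtain ⟨u, hu, rfl⟩ := List.mem_map.1 ha
        obtain ⟨u', hu', rfl⟩ := List.mem_map.1 (List.mem_reverse.1 hb)
        have h0 := congrFun hab 0
        simp only [Matrix.cons_val_zero] at h0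
        have hu0 := (hpb u hu).1
        have hu0' := (hqb u' hu').1
        omega
      · intro v hv
        rw [hw, List.mem_append, List.mem_reverse] at hv
        rw [SAW.mem_stripBox]
        rcases hv with hv | hv
        · obtain ⟨u, hu, rfl⟩ := List.mem_map.1 hv
          have hu' := hpb u hu
          simp only [Matrix.cons_val_zero, Matrix.cons_val_one, Matrix.cons_val_fin_one]
          push_cast
          omega
        · obtain ⟨u, hu, rfl⟩ := List.mem_map.1 hv
          have hu' := hqb u hu
          simp only [Matrix.cons_val_zero, Matrix.cons_val_one, Matrix.cons_val_fin_one]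
          push_cast
          omega
    · -- injective on `R × R`: the halves have `n + 1` vertices each
      rintro ⟨p, q⟩ hpq ⟨p', q'⟩ hpq' h
      obtain ⟨hp, -⟩ := Finset.mem_product.1 (Finset.mem_coe.1 hpq)
      obtain ⟨hp', -⟩ := Finset.mem_product.1 (Finset.mem_coe.1 hpq')
      dsimp only at h
      have hlen : (p.support.map fun u : Site 2 => (![u 0, u 1 + 1] : Site 2)).length =
          (p'.support.map fun u : Site 2 => (![u 0, u 1 + 1] : Site 2)).length := by
        rw [List.length_map, List.length_map, SimpleGraph.Walk.length_support,
          SimpleGraph.Walk.length_support, (hmem hp).1, (hmem hp').1]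
      obtain ⟨h1, h2⟩ := List.append_inj h hlen
      have e1 : p = p' := SimpleGraph.Walk.ext_support ((List.map_injective_iff.2 hinj₁) h1)
      have e2 : q = q' := SimpleGraph.Walk.ext_support
        ((List.map_injective_iff.2 hinj₂) (List.reverse_injective h2))
      rw [e1, e2]
  calc R.card ^ 2 = (R ×ˢ R).card := by rw [Finset.card_product, sq]
    _ ≤ (S.image SimpleGraph.Walk.support).card := key
    _ ≤ S.card := Finset.card_image_le

/-! ### A supercritical width exists above `x_c` -/

/-- For `x > x_c` some strip is supercritical at some span, `1 < x · Thr[x, W, ℓ]`: with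
`n, k, l` as in the module docstring (`x^{n+1} N > 1`), the glued pairs give
`x · Thr[x, l+1, 2k+1] ≥ x · x^{2n+1} N² = (x^{n+1} N)² > 1`. [folklore] -/
theorem exists_supercritical {x : ℝ} (hx : SAW.criticalFugacity < x) :
    ∃ W ℓ : ℕ, 1 < x * Thr[x, W, ℓ] := by
  obtain ⟨c, hc⟩ := SAW.DKY2014_lem5_step1_holds
  have hμ : 0 < SAW.connectiveConstant := SAW.planar_connectiveConstant_pos
  have hx0 : 0 < x := SAW.criticalFugacity_pos.trans hx
  have hρ : 1 < x * SAW.connectiveConstant := by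
    have h := mul_lt_mul_of_pos_right hx hμ
    rwa [SAW.criticalFugacity, inv_mul_cancel₀ hμ.ne'] at h
  obtain ⟨n, hn⟩ :=
    ((SAW.tendsto_pow_mul_exp_neg_sqrt_div hρ c).eventually_gt_atTop x⁻¹).exists
  have hlow : 0 < Real.exp (-(c * Real.sqrt n)) * SAW.connectiveConstant ^ n := by positivity
  have hpos : 0 < SAW.rectangleWalkCount n := by exact_mod_cast hlow.trans_le (hc n)
  obtain ⟨k, l, -, -, hkl⟩ := SAW.exists_kl_rectangleWalkCount_le hpos
  set N := (SAW.rectangleWalksTo n (SAW.RectanglePair.kl k l)).card with hN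
  have hden : (0 : ℝ) < (2 * n + 1) ^ 2 := by positivity
  have h1 : (x * SAW.connectiveConstant) ^ n * Real.exp (-(c * Real.sqrt n)) / (2 * n + 1) ^ 2 ≤
      x ^ n * N := by
    rw [div_le_iff₀ hden, mul_pow]
    have hkl' : (SAW.rectangleWalkCount n : ℝ) ≤ (2 * n + 1) ^ 2 * N := by exact_mod_cast hkl
    calc x ^ n * SAW.connectiveConstant ^ n * Real.exp (-(c * Real.sqrt n))
        = x ^ n * (Real.exp (-(c * Real.sqrt n)) * SAW.connectiveConstant ^ n) := by ring
      _ ≤ x ^ n * SAW.rectangleWalkCount n :=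
          mul_le_mul_of_nonneg_left (hc n) (pow_nonneg hx0.le n)
      _ ≤ x ^ n * ((2 * n + 1) ^ 2 * N) := mul_le_mul_of_nonneg_left hkl' (pow_nonneg hx0.le n)
      _ = x ^ n * N * (2 * n + 1) ^ 2 := by ring
  have hN1 : 1 < x ^ (n + 1) * N := by
    have h2 : x⁻¹ < x ^ n * N := hn.trans_le h1
    calc (1 : ℝ) = x * x⁻¹ := (mul_inv_cancel₀ hx0.ne').symm
      _ < x * (x ^ n * N) := mul_lt_mul_of_pos_left h2 hx0
      _ = x ^ (n + 1) * N := by ring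
  have hsq : (N : ℝ) ^ 2 ≤ ((SAW.stripSAWs (l + 1) (2 * k + 1) (2 * n + 1) (![0, 1] : Site 2)
      (![((2 * k + 1 : ℕ) : ℤ), 1] : Site 2)).card : ℝ) := by
    exact_mod_cast sq_card_rectangleWalksTo_le k l n
  refine ⟨l + 1, 2 * k + 1, ?_⟩
  calc (1 : ℝ) < (x ^ (n + 1) * N) ^ 2 := one_lt_pow₀ hN1 two_ne_zero
    _ = x * (x ^ (2 * n + 1) * (N : ℝ) ^ 2) := by ring
    _ ≤ x * (x ^ (2 * n + 1) * ((SAW.stripSAWs (l + 1) (2 * k + 1) (2 * n + 1)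
          (![0, 1] : Site 2) (![((2 * k + 1 : ℕ) : ℤ), 1] : Site 2)).card : ℝ)) :=
        mul_le_mul_of_nonneg_left (mul_le_mul_of_nonneg_left hsq (pow_nonneg hx0.le _)) hx0.le
    _ ≤ x * Thr[x, l + 1, 2 * k + 1] :=
        mul_le_mul_of_nonneg_left (term_le_zs hx0.le _ _ _ _ _) hx0.le

/-! ### The stub -/

/-- **S1 · width transition.** For `x_c < x < 1` there is a width `W ≥ 2` whose one-strand
through function is supercritical at some span (`x · Thr[x, W, ℓ] > 1`) while the `(W-1)`-strip
is subcritical in the `ε`-free sense `x · Thr[x, W-1, ℓ] ≤ 1` at every span: `W` is the least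
supercritical width (`exists_supercritical`, `Nat.find`); widths `0` (empty box, `thr_zero`) and
`1` (the single straight walk, `thr_one_le_one`) are never supercritical for `x < 1`, and
minimality of `W` is the subcritical clause. [folklore] -/
theorem stub_widthTransition :
    ∀ x : ℝ, SAW.criticalFugacity < x → x < 1 →
      ∃ W : ℕ, 2 ≤ W ∧ (∀ ℓ : ℕ, x * Thr[x, W - 1, ℓ] ≤ 1) ∧ (∃ ℓ : ℕ, 1 < x * Thr[x, W, ℓ]) := by
  intro x hx hx1
  have hx0 : 0 < x := SAW.criticalFugacity_pos.trans hx
  have hP := exists_supercritical hx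
  -- widths `0` and `1` are not supercritical
  have hlow : ∀ m < 2, ¬∃ ℓ : ℕ, 1 < x * Thr[x, m, ℓ] := by
    rintro m hm ⟨ℓ, hℓ⟩
    obtain rfl | rfl : m = 0 ∨ m = 1 := by omega
    · rw [thr_zero, mul_zero] at hℓ
      exact absurd hℓ (by norm_num)
    · have h := thr_one_le_one hx0.le hx1.le ℓ
      nlinarith
  classical
  have h2 : 2 ≤ Nat.find hP := (Nat.le_find_iff hP 2).2 hlow
  refine ⟨Nat.find hP, h2, fun ℓ => ?_, Nat.find_spec hP⟩
  have hmin := Nat.find_min hP (show Nat.find hP - 1 < Nat.find hP by omega)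
  push Not at hmin
  exact hmin ℓ

end Summit.CriticalPhenomena.SAWScalingLimit.Theorems.EdgeOfPositivity.RectangleWindows.WidthTransition

end
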